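import Literature.InformationTheory.QuantumCodes.RotatedSurfaceCode
import Literature.InformationTheory.QuantumCodes.OptimalRadius
import HarnessLib

/-!
# The rotated surface code is `[[L², 1, L]]` for every `L ≥ 1`, with optimal correction radius `⌊(L−1)/2⌋`

Topic `InformationTheory/QuantumCodes`; namespace `Literature.InformationTheory.QuantumCodes.RotatedSurface`.
LADDER-QEC (cell `qec`), PARTITION row 08, item 08.RSC (assembly; definitions in `RotatedSurfaceCode.lean`, distance
engine `CSSCode.dZ_eq_of_disjoint_lines` in `CSSDisjointLogicals.lean`).

* `linearIndependent_of_pivot` — a family of vectors each owning a «pivot» coordinate where it is non-zero and every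
  other member of no larger key vanishes is linearly independent (triangularity);
* `rank_HX`, `rank_HZ` — the valid `X`-faces (resp. `Z`-faces) give independent rows: sweep the `X`-faces by column
  (pivot qubit in column `b+1`), the `Z`-faces by row (pivot in row `a+1`); the wrong-colour faces are zero rows;
* `card_valid` — `#X-checks + #Z-checks = L² − 1` (for each interior index `t` the two colour classes partition the
  `L+1` virtual positions);
* `code_k` — **`k = 1`**; `code_dZ`, `code_dX` — **`d_Z = d_X = L`** (the `L` columns / rows are disjoint equivalent
  representatives of `X̄` / `Z̄`); `code_isCode` — **`RSC(L)` is `[[L², 1, L]]`** for every `L ≥ 1` (Surface-17/49/97 =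
  `L = 3, 5, 7`); `code_minWeight_correctsUpTo`, `code_radius_optimal` — radius `⌊(L−1)/2⌋` attained by minimum-weight
  sector decoding and optimal over all sector decoders.

0 named facts, no instances, no notation; axioms standard.

## References
* [BombinMartinDelgado2007Optimal] Bombin–Martin-Delgado, PRA 76 (2007) 012305 = arXiv:quant-ph/0703272 §IV (p0007 L1-9:
  the planar surface code family with `n/d² = 1`, i.e. `[[d², 1, d]]`).
* [TomitaSvore2014] Tomita–Svore, PRA 90 (2014) 062320 = arXiv:1404.3747 §2.2 (p0004 L45-59: Surface-17, «remain
  distance-three surface codes»).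
* [DennisEtAl2002] Dennis–Kitaev–Landahl–Preskill §3.2 (p0009 L9: «the shortest paths from rough edge to rough edge …
  contain L links»).
-/

namespace Literature.InformationTheory.QuantumCodes

open Matrix Finset

/-! ## Triangular families are independent -/

/-- **Pivot (triangularity) criterion for linear independence**: if each `v i` has a coordinate `piv i` with
`v i (piv i) ≠ 0` at which every other `v j` with `key j ≤ key i` vanishes, the family is linearly independent.
[cite: DennisEtAl2002, §3.2 (independent check operators of the planar code)] -/
theorem linearIndependent_of_pivot {ι Q K : Type*} [Field K] [Fintype ι] (v : ι → Q → K)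
    (key : ι → ℕ) (piv : ι → Q) (h1 : ∀ i, v i (piv i) ≠ 0)
    (h2 : ∀ i j, j ≠ i → key j ≤ key i → v j (piv i) = 0) : LinearIndependent K v := by
  classical
  rw [Fintype.linearIndependent_iff]
  intro g hg
  by_contra hne
  obtain ⟨i₁, hi₁⟩ := not_forall.1 hne
  -- a non-zero coefficient of maximal key
  obtain ⟨i₀, hi₀, hmax⟩ := Finset.exists_max_image (Finset.univ.filter fun i => g i ≠ 0) key
    ⟨i₁, by simpa using hi₁⟩
  have hg0 : g i₀ ≠ 0 := by simpa using hi₀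
  have heval := congr_fun hg (piv i₀)
  rw [Finset.sum_apply, Pi.zero_apply] at heval
  rw [Finset.sum_eq_single i₀] at heval
  · simp only [Pi.smul_apply, smul_eq_mul] at heval
    exact (mul_ne_zero hg0 (h1 i₀)) heval
  · intro j _ hj
    simp only [Pi.smul_apply, smul_eq_mul]
    by_cases hgj : g j = 0
    · rw [hgj, zero_mul]
    · rw [h2 i₀ j hj (hmax j (by simpa using hgj)), mul_zero]
  · intro h; exact absurd (Finset.mem_univ i₀) h

/-- **Rank from independent non-zero rows**: if the rows of `A` indexed by a subtype `P` are linearly independent and all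
other rows vanish, then `rank A = #P`. [cite: DennisEtAl2002, §3.2 (counting independent stabilizer generators)] -/
theorem rank_eq_card_of_rows {R Q : Type*} [Fintype R] [Fintype Q] [DecidableEq Q] (A : Matrix R Q (ZMod 2))
    (P : R → Prop) [DecidablePred P] (hind : LinearIndependent (ZMod 2) fun r : {r // P r} => A r.1)
    (hzero : ∀ r, ¬ P r → A r = 0) : A.rank = Fintype.card {r // P r} := by
  rw [← finrank_rowSpace_eq_rank]
  have h1 : rowSpace A = Submodule.span (ZMod 2) (Set.range A.row) := range_vecMulLinear A
  rw [h1]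
  have hspan : Submodule.span (ZMod 2) (Set.range A.row) = Submodule.span (ZMod 2) (Set.range fun r : {r // P r} => A r.1) := by
    refine le_antisymm (Submodule.span_le.2 ?_) (Submodule.span_mono ?_)
    · rintro _ ⟨r, rfl⟩
      by_cases hr : P r
      · exact Submodule.subset_span ⟨⟨r, hr⟩, rfl⟩
      · rw [Matrix.row_apply', hzero r hr]; exact Submodule.zero_mem _
    · rintro _ ⟨r, rfl⟩; exact ⟨r.1, rfl⟩
  rw [hspan, finrank_span_eq_card hind]

namespace RotatedSurface

variable {L : ℕ}

/-! ## The checks are independent -/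

/-- Valid `X`-faces have `vx = 1`, invalid ones `vx = 0` (zero rows). [cite: TomitaSvore2014, §2.2 (p0004 L45-48)] -/
theorem HX_eq_zero_of_invalid (x : Fin (L + 1) × Fin (L - 1)) (hx : ¬ (x.1.val + x.2.val) % 2 = 1) : HX L x = 0 := by
  funext q; simp [HX, vx, hx]

/-- Invalid `Z`-faces are zero rows. [cite: TomitaSvore2014, §2.2 (p0004 L45-48)] -/
theorem HZ_eq_zero_of_invalid (z : Fin (L - 1) × Fin (L + 1)) (hz : ¬ (z.1.val + z.2.val) % 2 = 0) : HZ L z = 0 := by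
  funext q; simp [HZ, vz, hz]

/-- **The valid `X`-rows are linearly independent**: face `(a', b)` owns the qubit `(min a' (L−1), b+1)` in column
`b+1`; faces of smaller-or-equal column index vanish there (same column index ⇒ same colour ⇒ rows two apart).
[cite: DennisEtAl2002, §3.2 (independent stabilizer generators of the planar code)] -/
theorem linearIndependent_HX :
    LinearIndependent (ZMod 2) fun x : {x : Fin (L + 1) × Fin (L - 1) // (x.1.val + x.2.val) % 2 = 1} => HX L x.1 := by
  refine linearIndependent_of_pivot _ (fun x => x.1.2.val)
    (fun x => (⟨min x.1.1.val (L - 1), by have := x.1.2.isLt; omega⟩, ⟨x.1.2.val + 1, by have := x.1.2.isLt; omega⟩)) ?_ ?_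
  · intro x
    have hx := x.2; have ha := x.1.1.isLt; have hb := x.1.2.isLt
    show (if (x.1.1.val + x.1.2.val) % 2 = 1 then (1 : ZMod 2) else 0) *
      ((if min x.1.1.val (L - 1) + 1 = x.1.1.val ∨ min x.1.1.val (L - 1) = x.1.1.val then (1 : ZMod 2) else 0) *
       (if x.1.2.val + 1 = x.1.2.val ∨ x.1.2.val + 1 = x.1.2.val + 1 then (1 : ZMod 2) else 0)) ≠ 0
    rw [if_pos hx, if_pos (by omega), if_pos (Or.inr rfl), one_mul, one_mul]
    exact one_ne_zero
  · -- a face `y ≠ x` of column index `≤` that of `x` vanishes at the pivot of `x`: either its columns miss `b+1`,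
    -- or it has the same column index, hence the same colour, and its rows are two apart from those of `x`
    intro x y hxy hkey
    have hx := x.2; have hy := y.2
    have ha := x.1.1.isLt; have hb := x.1.2.isLt; have hc := y.1.1.isLt
    change y.1.2.val ≤ x.1.2.val at hkey
    show (if (y.1.1.val + y.1.2.val) % 2 = 1 then (1 : ZMod 2) else 0) *
      ((if min x.1.1.val (L - 1) + 1 = y.1.1.val ∨ min x.1.1.val (L - 1) = y.1.1.val then (1 : ZMod 2) else 0) *
       (if x.1.2.val + 1 = y.1.2.val ∨ x.1.2.val + 1 = y.1.2.val + 1 then (1 : ZMod 2) else 0)) = 0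
    by_cases hcol : x.1.2.val + 1 = y.1.2.val ∨ x.1.2.val + 1 = y.1.2.val + 1
    · have hdb : y.1.2.val = x.1.2.val := by omega
      have hac : x.1.1.val ≠ y.1.1.val := fun h =>
        hxy (Subtype.ext (Prod.ext (Fin.ext h.symm) (Fin.ext hdb)))
      rw [if_neg (by omega : ¬(min x.1.1.val (L - 1) + 1 = y.1.1.val ∨ min x.1.1.val (L - 1) = y.1.1.val)),
        zero_mul, mul_zero]
    · rw [if_neg hcol, mul_zero, mul_zero]

/-- **The valid `Z`-rows are linearly independent** (sweep by row; pivot qubit `(a+1, min b' (L−1))`).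
[cite: DennisEtAl2002, §3.2 (independent stabilizer generators of the planar code)] -/
theorem linearIndependent_HZ :
    LinearIndependent (ZMod 2) fun z : {z : Fin (L - 1) × Fin (L + 1) // (z.1.val + z.2.val) % 2 = 0} => HZ L z.1 := by
  refine linearIndependent_of_pivot _ (fun z => z.1.1.val)
    (fun z => (⟨z.1.1.val + 1, by have := z.1.1.isLt; omega⟩, ⟨min z.1.2.val (L - 1), by have := z.1.1.isLt; omega⟩)) ?_ ?_
  · intro z
    have hz := z.2; have ha := z.1.1.isLt; have hb := z.1.2.isLt
    show (if (z.1.1.val + z.1.2.val) % 2 = 0 then (1 : ZMod 2) else 0) *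
      ((if z.1.1.val + 1 = z.1.1.val ∨ z.1.1.val + 1 = z.1.1.val + 1 then (1 : ZMod 2) else 0) *
       (if min z.1.2.val (L - 1) + 1 = z.1.2.val ∨ min z.1.2.val (L - 1) = z.1.2.val then (1 : ZMod 2) else 0)) ≠ 0
    rw [if_pos hz, if_pos (Or.inr rfl), if_pos (by omega), one_mul, one_mul]
    exact one_ne_zero
  · intro z y hzy hkey
    have hz := z.2; have hy := y.2
    have ha := z.1.1.isLt; have hb := z.1.2.isLt; have hd := y.1.2.isLt
    change y.1.1.val ≤ z.1.1.val at hkey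
    show (if (y.1.1.val + y.1.2.val) % 2 = 0 then (1 : ZMod 2) else 0) *
      ((if z.1.1.val + 1 = y.1.1.val ∨ z.1.1.val + 1 = y.1.1.val + 1 then (1 : ZMod 2) else 0) *
       (if min z.1.2.val (L - 1) + 1 = y.1.2.val ∨ min z.1.2.val (L - 1) = y.1.2.val then (1 : ZMod 2) else 0)) = 0
    by_cases hrow : z.1.1.val + 1 = y.1.1.val ∨ z.1.1.val + 1 = y.1.1.val + 1
    · have hca : y.1.1.val = z.1.1.val := by omega
      have hbd : z.1.2.val ≠ y.1.2.val := fun h =>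
        hzy (Subtype.ext (Prod.ext (Fin.ext hca) (Fin.ext h.symm)))
      rw [if_neg (by omega : ¬(min z.1.2.val (L - 1) + 1 = y.1.2.val ∨ min z.1.2.val (L - 1) = y.1.2.val)),
        mul_zero, mul_zero]
    · rw [if_neg hrow, zero_mul, mul_zero]

/-- `rank H_X = #(valid X-faces)`. [cite: DennisEtAl2002, §3.2] -/
theorem rank_HX (L : ℕ) :
    (HX L).rank = Fintype.card {x : Fin (L + 1) × Fin (L - 1) // (x.1.val + x.2.val) % 2 = 1} :=
  rank_eq_card_of_rows (HX L) (fun x => (x.1.val + x.2.val) % 2 = 1) linearIndependent_HX HX_eq_zero_of_invalid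

/-- `rank H_Z = #(valid Z-faces)`. [cite: DennisEtAl2002, §3.2] -/
theorem rank_HZ (L : ℕ) :
    (HZ L).rank = Fintype.card {z : Fin (L - 1) × Fin (L + 1) // (z.1.val + z.2.val) % 2 = 0} :=
  rank_eq_card_of_rows (HZ L) (fun z => (z.1.val + z.2.val) % 2 = 0) linearIndependent_HZ HZ_eq_zero_of_invalid

/-- **`#X-checks + #Z-checks = L² − 1`**: for each interior index `t ∈ [0, L−2]` the `X`-faces `(a', t)` with `a' + t` odd
and the `Z`-faces `(t, b')` with `t + b'` even partition the `L + 1` virtual positions.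
[cite: TomitaSvore2014, §2.2 (p0004 L46: Surface-17 — 9 data qubits, 8 stabilizers)] -/
theorem card_valid (L : ℕ) :
    Fintype.card {x : Fin (L + 1) × Fin (L - 1) // (x.1.val + x.2.val) % 2 = 1}
      + Fintype.card {z : Fin (L - 1) × Fin (L + 1) // (z.1.val + z.2.val) % 2 = 0} = (L - 1) * (L + 1) := by
  classical
  rw [Fintype.card_subtype, Fintype.card_subtype, Finset.card_filter, Finset.card_filter, Fintype.sum_prod_type,
    Fintype.sum_prod_type, Finset.sum_comm, ← Finset.sum_add_distrib]
  have hrow : ∀ t : Fin (L - 1), (∑ a : Fin (L + 1), if (a.val + t.val) % 2 = 1 then 1 else 0)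
      + (∑ b : Fin (L + 1), if (t.val + b.val) % 2 = 0 then 1 else 0) = L + 1 := by
    intro t
    rw [← Finset.sum_add_distrib]
    have e : ∀ u : Fin (L + 1), ((if (u.val + t.val) % 2 = 1 then 1 else 0) + if (t.val + u.val) % 2 = 0 then 1 else 0) = 1 := by
      intro u; split_ifs <;> omega
    simp_rw [e]
    simp
  simp_rw [hrow]
  simp [mul_comm]

/-- **`k = 1`** for the rotated surface code, every `L ≥ 1`. [cite: TomitaSvore2014, §2.2 (p0004 L46-59: 9 data qubits, 8 stabilizers, one logical qubit)] [cite: BombinMartinDelgado2007Optimal, §IV (p0007 L1-9: single-qubit planar codes)] -/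
theorem code_k (hL : 0 < L) : (code L).k = 1 := by
  rw [CSSCode.k_eq, code_HX, code_HZ, rank_HX, rank_HZ, card_qubits]
  have h := card_valid L
  have h1 : (L - 1) * (L + 1) + 1 = L * L := by
    cases L with
    | zero => omega
    | succ n => simp; ring
  omega

/-! ## Distances and parameters -/

/-- **`d_Z = L`**: the `L` columns are disjoint representatives of `X̄` differing by `X`-stabilizers, and row `0` is a
`Z`-logical of weight `L` crossing column `0` once. [cite: DennisEtAl2002, §3.2 (p0009 L9: «the shortest paths from rough edge to rough edge … contain L links»)] [cite: BombinMartinDelgado2007Optimal, §IV (p0007 L1-9: distance d with n = d²)] -/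
theorem code_dZ (hL : 0 < L) : (code L).dZ = L := by
  refine (code L).dZ_eq_of_disjoint_lines hL col col_disjoint col_add_col_mem_rowSpX ?_ (row ⟨0, hL⟩) ?_ ?_
    (hammingNorm_row_le _) (code_k hL)
  · rw [code_HZ]; exact HZ_mulVec_col _
  · rw [code_HX]; exact HX_mulVec_row _
  · exact row_dotProduct_col _ _

/-- **`d_X = L`**: symmetrically, the rows are disjoint representatives of `Z̄` differing by `Z`-stabilizers, and column
`0` is an `X`-logical of weight `L` (the engine applied to the `X ↔ Z` exchanged code).
[cite: DennisEtAl2002, §3.2 (p0009 L9: «and from smooth edge to smooth edge, both contain L links»)] -/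
theorem code_dX (hL : 0 < L) : (code L).dX = L := by
  rw [← CSSCode.dZ_swap]
  refine (code L).swap.dZ_eq_of_disjoint_lines hL row row_disjoint ?_ ?_ (col ⟨0, hL⟩) ?_ ?_
    (hammingNorm_col_le _) (by rw [CSSCode.k_swap]; exact code_k hL)
  · intro i i' h
    exact row_add_row_mem_rowSpZ i i' h
  · show (code L).HX *ᵥ row ⟨0, hL⟩ = 0
    rw [code_HX]; exact HX_mulVec_row _
  · show (code L).HZ *ᵥ col ⟨0, hL⟩ = 0
    rw [code_HZ]; exact HZ_mulVec_col _
  · exact col_dotProduct_row _ _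

/-- **The rotated surface code `RSC(L)` is `[[L², 1, L]]`, for every `L ≥ 1`** (Surface-17, -49, -97, … for
`L = 3, 5, 7, …`). [cite: BombinMartinDelgado2007Optimal, §IV (p0007 L1-9: planar surface codes with n/d² = 1 — «(b) with approximately half the number of qubits and equal distance»)] [cite: TomitaSvore2014, §2.2 (p0004 L45-59: Surface-17 «remain[s] distance-three»)] -/
theorem code_isCode (hL : 0 < L) : (code L).IsCode (L * L) 1 L := by
  have hk := code_k hL
  have h := (code L).isCode_of_dX_dZ (by rw [hk]; exact one_pos) (code_dX hL) (code_dZ hL)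
  rwa [card_qubits, hk, min_self] at h

/-- `L = 3`: the 9-data-qubit rotated surface code («Surface-17») is `[[9, 1, 3]]`. [cite: TomitaSvore2014, §2.2 (p0004 L45-59)] -/
theorem surface17_isCode : (code 3).IsCode 9 1 3 := code_isCode (L := 3) (by norm_num)

/-- `L = 5`: `[[25, 1, 5]]`. [cite: BombinMartinDelgado2007Optimal, §IV (p0007 L3-8: the d = 5 planar surface code of version (b))] -/
theorem surface49_isCode : (code 5).IsCode 25 1 5 := code_isCode (L := 5) (by norm_num)

/-- `L = 7`: `[[49, 1, 7]]`. [cite: BombinMartinDelgado2007Optimal, §IV (p0007 L1-9)] -/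
theorem surface97_isCode : (code 7).IsCode 49 1 7 := code_isCode (L := 7) (by norm_num)

/-- **Correction radius of `RSC(L)`, attained**: minimum-weight decoding of each sector corrects every pattern of weight
`≤ ⌊(L−1)/2⌋`. [cite: DennisEtAl2002, §3.2] [cite: TomitaSvore2014, §2.2 (p0004 L59)] -/
theorem code_minWeight_correctsUpTo (hL : 0 < L) :
    (Decoder.minWeight (code L).zSyndrome hammingNorm).CorrectsUpTo (code L).zSyndrome
        ((code L).rowSpZ : Set (Fin L × Fin L → ZMod 2)) hammingNorm ((L - 1) / 2) ∧
      (Decoder.minWeight (code L).xSyndrome hammingNorm).CorrectsUpTo (code L).xSyndrome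
        ((code L).rowSpX : Set (Fin L × Fin L → ZMod 2)) hammingNorm ((L - 1) / 2) :=
  ⟨(code_isCode hL).minWeight_correctsUpToZ, (code_isCode hL).minWeight_correctsUpToX⟩

/-- **… and optimal**: no pair of sector decoders of `RSC(L)` corrects all weight-`t` patterns in both sectors unless
`t ≤ ⌊(L−1)/2⌋`. [cite: DennisEtAl2002, §3.2] -/
theorem code_radius_optimal (hL : 0 < L) {DX : Decoder (Fin (L - 1) × Fin (L + 1) → ZMod 2) (Fin L × Fin L → ZMod 2)}
    {DZ : Decoder (Fin (L + 1) × Fin (L - 1) → ZMod 2) (Fin L × Fin L → ZMod 2)} {t : ℕ}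
    (hDX : DX.CorrectsUpTo (code L).xSyndrome ((code L).rowSpX : Set (Fin L × Fin L → ZMod 2)) hammingNorm t)
    (hDZ : DZ.CorrectsUpTo (code L).zSyndrome ((code L).rowSpZ : Set (Fin L × Fin L → ZMod 2)) hammingNorm t) :
    t ≤ (L - 1) / 2 :=
  (code_isCode hL).le_half_of_correctsUpTo_sectors hDX hDZ

end RotatedSurface

end Literature.InformationTheory.QuantumCodes
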